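import Mathlib

/-!
# KPlusLogSqLaw — the two-speed parity law: where the alphabet boundary lies (kernel-checked instances)

Context (route `KPlusLogSqLaw`, crux `TropicalB`, cell pub-symmetroid, seat conjb-2 g19–g20).  For max-weight matchings
on a path with `N` edges and edge weights `A e + lam e * T` moving at integer speeds `lam e`, follow the optimum as `T`
increases; call a change between consecutive optima an *odd block* when the two matchings have sizes of different
parity (the symmetric difference is then an interval block of odd length).  The *two-speed parity law* (the realisable
form `HullDComb` of the refuted abstract statement `KPlusLogSqLaw.DComb`, item 28100) asserts: for speeds in `{±1, ±2}`
the number of odd blocks is at most `N`.  It is certified by exact rational LP certificates for all `N ≤ 14`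
(kit job j322292), and its local *Hall form* — every edge interval `I` contains at most `|I|` odd blocks — for all
`N ≤ 9` (conjb-2 g20, THEORY-NOTE-g20 §5).

This file pins the two boundaries of that phenomenon in the kernel, by explicit integer instances found by the exact
LP search and verified here by `decide`:

* `threeSpeed_parityLaw_counterexample` — with THREE speeds `{±1, ±3, ±5}` the law fails already at `N = 5`: a chain of
  seven consecutive unique optima with six odd blocks (the «resonance gadget» (s,p,s | guards −p, −Q) with p ≥ 2s+1,
  Q ≥ p+s+1).
* `twoSpeed13_localHallForm_counterexample` — with two speeds `{±1, ±3}` (ratio q ≥ 2p+1) the LOCAL Hall form fails at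
  `N = 6`: the 3-edge interval `{3,4,5}` hosts four odd blocks (lone 3, lone 4, lone 5 and the shrink `{3,5} → {4}`, whose
  slope gain `q − 2p = 1` is positive exactly when q ≥ 2p+1), while the global count (5 ≤ 6) still obeys the law.

In both statements `μ k` is required to be the UNIQUE maximum-weight independent edge set at time `T k` (strict
inequality against every other independent set), with `T` strictly increasing; so `μ 0, …, μ L` are consecutive vertices
of the upper hull («hull chain piece») of a genuine instance.  No new definitions; both proofs are `decide`.
-/

namespace Summit.ValiantsHypothesis.ValiantsHypothesis.Theorems.KPlusLogSqLawParityAlphabetBoundary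

/-- **Three speeds break the parity law.**  Path with `N = 5` edges `0,…,4` (edges `e`, `e+1` adjacent), speeds
`lam = (-5,-3,1,3,1) ∈ {±1,±3,±5}`, offsets `A = (-5,21,21,3,-7)`, times `T = (-42,-13,-3,1,5,9,32)`: at each `T k` the
set `μ k` (`{0}, {0,2}, {1}, {1,3}, {2}, {2,4}, {3}`) is the unique max-weight independent edge set, and all six
consecutive changes are odd blocks (`[2,2] [0,2] [3,3] [1,3] [4,4] [2,4]`), so `#odd = 6 > N = 5`.
(conjb-2 g19/g20 exact LP; rational witness `a = (-5/21,1,1,1/7,-1/3)` scaled by 21.) -/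
theorem threeSpeed_parityLaw_counterexample :
    ∃ (lam A : Fin 5 → ℤ) (T : Fin 7 → ℤ) (μ : Fin 7 → Finset (Fin 5)),
      (∀ e, lam e = 1 ∨ lam e = -1 ∨ lam e = 3 ∨ lam e = -3 ∨ lam e = 5 ∨ lam e = -5) ∧
      StrictMono T ∧
      (∀ k, ∀ e ∈ μ k, ∀ e' ∈ μ k, e'.val ≠ e.val + 1) ∧
      (∀ k (ν : Finset (Fin 5)), (∀ e ∈ ν, ∀ e' ∈ ν, e'.val ≠ e.val + 1) → ν ≠ μ k →
          ∑ e ∈ ν, (A e + lam e * T k) < ∑ e ∈ μ k, (A e + lam e * T k)) ∧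
      5 < (Finset.univ.filter (fun k : Fin 6 => Odd ((μ k.castSucc).card + (μ k.succ).card))).card := by
  refine ⟨![-5, -3, 1, 3, 1], ![-5, 21, 21, 3, -7], ![-42, -13, -3, 1, 5, 9, 32],
    ![{0}, {0, 2}, {1}, {1, 3}, {2}, {2, 4}, {3}], by decide, ?_, by decide, by decide, by decide⟩
  exact Fin.strictMono_iff_lt_succ.mpr (by decide)

/-- **Ratio `q ≥ 2p+1` breaks the LOCAL Hall form (two speeds `{±1,±3}`).**  Path with `N = 6` edges, speeds
`lam = (-3,3,3,1,3,1)`, offsets `A = (28,28,24,20,0,-8)`, times `T = (-48,-11,-1,2,6,10,40)`: the unique optima are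
`μ = {0}, {0,3}, {0,2}, {0,2,4}, {1,3}, {1,3,5}, {1,4}` (blocks `[3,3] [2,3] [4,4] [0,4] [5,5] [3,5]`); four of the six
changes are odd blocks supported inside the edge interval `{3,4,5}`, exceeding its length 3 — a violation of the Hall
form «#odd blocks inside I ≤ |I|» that is certified impossible for speeds `{±1,±2}` (all `N ≤ 9`).  The total number of odd
blocks is 5 ≤ N = 6.  (conjb-2 g20 exact LP; rational witness `a = (1,1,6/7,5/7,0,-2/7)` scaled by 28.) -/
theorem twoSpeed13_localHallForm_counterexample :
    ∃ (lam A : Fin 6 → ℤ) (T : Fin 7 → ℤ) (μ : Fin 7 → Finset (Fin 6)),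
      (∀ e, lam e = 1 ∨ lam e = -1 ∨ lam e = 3 ∨ lam e = -3) ∧
      StrictMono T ∧
      (∀ k, ∀ e ∈ μ k, ∀ e' ∈ μ k, e'.val ≠ e.val + 1) ∧
      (∀ k (ν : Finset (Fin 6)), (∀ e ∈ ν, ∀ e' ∈ ν, e'.val ≠ e.val + 1) → ν ≠ μ k →
          ∑ e ∈ ν, (A e + lam e * T k) < ∑ e ∈ μ k, (A e + lam e * T k)) ∧
      3 < (Finset.univ.filter (fun k : Fin 6 =>
            Odd ((μ k.castSucc).card + (μ k.succ).card) ∧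
            symmDiff (μ k.castSucc) (μ k.succ) ⊆ ({3, 4, 5} : Finset (Fin 6)))).card := by
  refine ⟨![-3, 3, 3, 1, 3, 1], ![28, 28, 24, 20, 0, -8], ![-48, -11, -1, 2, 6, 10, 40],
    ![{0}, {0, 3}, {0, 2}, {0, 2, 4}, {1, 3}, {1, 3, 5}, {1, 4}], by decide, ?_, by decide, by decide, by decide⟩
  exact Fin.strictMono_iff_lt_succ.mpr (by decide)

end Summit.ValiantsHypothesis.ValiantsHypothesis.Theorems.KPlusLogSqLawParityAlphabetBoundary
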